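import Summits.QuantumFields.YangMills.Theorems.BalabanUVNodesN18HLayerW1SpaceRestr

/-!
# BalabanUVNodes ∕ N18 — THE RESTRICTION CLAUSE IN PRINT's SHAPE: TWO TABLES (the space on `X` read inside a LARGER space on every `Z ⊂ X`), the
# any-table (1.18) ∕ analyticity producers and [I] Theorem 1's induction re-run on a table PAIR, and the pair OF RECORD «`U^c_j(X, α₀, α₁)` ⊆ the
# (i)–(iii)-orbits on `Z` with radii `α′ ≥ α`» PROVED FOR EVERY RESIDUAL RECIPE (Track A, DAG node N18 = NE5 `T4OutputRate.NE5 EA EB W κ θ C₅` :211; cluster K4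
# «SpineRates»; file 21 of seat pub-ymgap-dag-n18-c, row s1, generation 5)

Cell `pub-ymgap`, HUMAN RULING D-0062 (Track A), R134 ACCELERATION seat `pub-ymgap-dag-n18-c` (strategy s1), generation 5.  THEOREMS ONLY (no `def` ∕ `instance` ∕
`sorry`); imports file 20 `…N18HLayerW1SpaceRestr` (hence files 9 ∕ 10, `Node00/RateRecordW1*`, `Sect2*`, `B12RegularSpaces111(Mono)`) BY NAME; restates nothing.  K3‴ helper.

WHY.  File 20 located it: the same-table restriction property `W1.SpRestr sp` («Z ⊂ X ⟹ sp X ⊆ sp Z») that files 9–18 display holds at the table of record only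
because the residual recipe of record is the UNIT placeholder (C3); print restricts THROUGH A LARGER SPACE — [II] p. 15: «The quadratic forms and covariances in
H(Z) are analytic functions on the space of configurations (U, J) satisfying the conditions I.(i)–(iii) on the domain Z, with constants α₀′, α₁′ much bigger than
α₀, α₁, therefore we can restrict them, as analytic functions, to the above subspace» `U^c_{k+1}(X, α₀, α₁)`.  THIS FILE re-runs the configuration-direction chain
on a TABLE PAIR `(sp, sp′)`: the inductive assumptions ((1.18), [I] p. 263 analyticity) live on `sp`, the step's H-layer pair (`AnalyticH`, `Bound238`) is asked on the
larger `sp′`, and the only link is the two-table restriction clause `hrestr : ∀ X Z, Z ⊂ X → sp X ⊆ sp′ Z` (§1–§3; the one-table files are the diagonal `sp′ = sp`, §4).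
Then (§5) the pair OF RECORD — `sp := W1.spaceOfRecord Sg Rz α₀ α₁` (conditions (i)–(iv)) and `sp′ :=` the union of `Gᶜ`-orbits of the pairs satisfying (i)–(iii) on the
frame of `Z` with radii `α₀′ j ≥ α₀ j`, `α₁′ j ≥ α₁ j` (print's space above) — satisfies the clause FOR EVERY residual recipe `Rz`, with NO law on it: conditions
(i)–(iii) and the orbit structure are antitone in the frame (file 20 §1) and monotone in the radii (r2's `…Mono`), and condition (iv) — the only domain-dependent one —
is simply not asked on `Z`.  So the chain no longer leans on (C3).

WHAT (theorems only).
* §1 any torus: `exists_nbhd_hLayer_of_analyticH_bound238₂`, `analyticOnNhd_and_bound_E_of_bound238_table₂` (file 10 §1 ∕ §2∘§1 on a pair: `E^{(k+1)}(X)` analytic on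
  `sp X` and (2.41)-bounded there from the H-layer pair ON `sp′`, STRICT [KP86] clause).
* §2 at `F.P K` (d = 4 numerals): `analyticOnNhd_and_bound_E_of_bound238_table_four₂`, `termAnalytic_of_bound238_table₂`, `termBound118_of_bound238_table₂`.
* §3 [I] THEOREM 1's INDUCTION ON A PAIR: `inductiveAssumptions_of_inductiveStep₂` ((STEP₂): (1.18)`(E₀,r₁)` ∧ analyticity on `sp` at levels `≤ k` ⟹ the step-`k` pair on
  `sp′ (k+1)`; both inductive assumptions on `sp` at every level), `hLayer_all∕termBound118∕termAnalytic_of_inductiveStep₂`; §4 `restr₂_of_spRestr` (the diagonal).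
* §5 PRINT's PAIR, ANY RESIDUAL RECIPE: `satisfiesI_III_anti_frame`, ★ `space_subset_orbitI_III` (`U^c(F, α) ⊆ {(i)–(iii)-orbits on F′, radii α′}`, refined frame,
  `α ≤ α′`, `0 ≤ O(1)LMB`), ★★ `spaceOfRecord_subset_orbitI_III` (at W1's table, EVERY `Rz`), ★★★ `restr₂_spaceOfRecord_orbitI_III` (the clause of §1–§3 for the pair of
  record) and `termBound118_spaceOfRecord_of_pair` ((1.18) ON THE TABLE OF RECORD from the H-layer pair on print's larger (i)–(iii) space; no residual-recipe law, no (C3)).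

HONEST FRAMING.  Count-neutral kernel bookkeeping (§1–§3 = files 10 ∕ 15's proofs with `sp′` at the step's pair; §5 = set inclusion over [I] (1.11)–(1.16) as typed);
NOT a discharge of N18 (typed 28∕28 · discharged 5∕27 UNCHANGED); the H-layer pair on the larger space is NODE A's ∕ N10's content, DISPLAYED; nothing of Bałaban's
analysis asserted; NE5 NOT IN PRINT ∕ NOT PROVED; finite four-torus at fixed ε — NOT infinite volume ∕ OS ∕ mass gap ∕ Clay.  0 `sorry`, 0 `def`, standard axioms.

References (TYPES only): [II] = [Balaban1988RG2Cluster] p. 15, (2.38) p. 20, (2.41) p. 21; [I] = [Balaban1987RG1] (1.11)–(1.19) pp. 262–263, Thm 1 p. 259, (3.16) p. 273.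
-/

noncomputable section

namespace Summit.QuantumFields.YangMills.BalabanUVNodes.N18HLayerW1TwoRadii

open Set Metric
open scoped Matrix.Norms.L2Operator
open Literature.MathematicalPhysics.QuantumFieldTheory.Balaban1983to89
open Step B14DomainGeom B14.Eq213MaximalDomains B15Eq112TorusCover TreeLengthTorus
open Literature.MathematicalPhysics.QuantumFieldTheory.Balaban1983to89.B12RegularSpaces111
open Literature.MathematicalPhysics.QuantumFieldTheory.Balaban1983to89.B12RegularSpaces111Mono (satisfiesI_III_mono)
open Literature.MathematicalPhysics.QuantumFieldTheory.Balaban1983to89.T4Continuum (T4Family)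
open Literature.MathematicalPhysics.QuantumFieldTheory.Balaban1983to89.TreeLengthTorusGeometry (tgeometry)
open Literature.MathematicalPhysics.QuantumFieldTheory.Balaban1983to89.B12TreeDecay (K₀)
open Literature.MathematicalPhysics.QuantumFieldTheory.Balaban1983to89.Node00
open Literature.MathematicalPhysics.QuantumFieldTheory.Balaban1983to89.Node00.Sect2 (regionOfSet innerT cubesI frameI spaceI domSys domCount domSites Residual Setting
  embedPair CPair regionOfSet_plaqs_mono regionOfSet_bonds_mono regionOfSet_dpairs_mono)
open Literature.MathematicalPhysics.QuantumFieldTheory.Balaban1983to89.Node00.W1 (spaceOfRecord SpRestr ClusterStep ClusterTower TermBound118 TermAnalytic termC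
  termC_zero termC_succ restrictPrefix)
open Literature.MathematicalPhysics.QuantumFieldTheory.Balaban1983to89.Node00.W1.ClusterStep (domSites_mono)
open Summit.QuantumFields.YangMills.BalabanUVNodes.N18HLayerW1Config (tgeometry_consts_FP)
open Summit.QuantumFields.YangMills.BalabanUVNodes.N18HLayerW1ConfigRecord (analyticOnNhd_and_bound_E_of_hLayer le_of_forall_gt_amplitude)
open Summit.QuantumFields.YangMills.BalabanUVNodes.N18HLayerW1SpaceRestr (condI_anti_frame condII_anti_region condIII_anti_region cubesI_refine)

/-! ## §1 Any torus: the neighbourhood extension and (2.39)–(2.41) on a table PAIR -/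

section Pair

variable {P : Params} {𝔸 : Type*} [NormedRing 𝔸] [NormedAlgebra ℂ 𝔸] {M k : ℕ}

/-- **THE NEIGHBOURHOOD EXTENSION ON A PAIR** (file 10 §1 with the step's pair on the larger table): two tables `sp ⊆ sp′` linked by print's clause
`hrestr : ∀ X Z, Z ⊂ X ⟹ sp X ⊆ sp′ Z`, the activities analytic at the points of `sp′` and (2.38)-bounded on `sp′`, a slack `A < A′` ⟹ for every `g ∈ Wk`,
`X ∈ 𝐃_{k+1}` an OPEN `V ⊇ sp X` on which every `φ ↦ S.H g φ Z`, `Z ⊆ X`, is ℂ-differentiable and `≤ A′e^{−R d(Z)}`. [cite: Balaban1988RG2Cluster, p.15 and Lemma 3 (2.38) p.20] -/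
theorem exists_nbhd_hLayer_of_analyticH_bound238₂ (S : ClusterStep P 𝔸 M k) (Wk : Set (Fin (k + 1) → ℝ))
    (sp sp' : (domSys P M (k + 1)).Dom → Set (CPair P 𝔸)) {A A' R : ℝ}
    (hrestr : ∀ X Z : (domSys P M (k + 1)).Dom, Z.1 ⊆ X.1 → sp X ⊆ sp' Z) (han : S.AnalyticH Wk sp')
    (h238 : S.Bound238 Wk sp' A R) (hAA' : A < A') :
    ∀ g ∈ Wk, ∀ X : (domSys P M (k + 1)).Dom, ∃ V : Set (CPair P 𝔸), IsOpen V ∧ sp X ⊆ V ∧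
      (∀ Z : (domSys P M (k + 1)).Dom, Z.1 ⊆ X.1 → DifferentiableOn ℂ (fun φ => S.H g φ Z) V) ∧
      (∀ φ ∈ V, ∀ Z : (domSys P M (k + 1)).Dom, Z.1 ⊆ X.1 →
        ‖S.H g φ Z‖ ≤ A' * Real.exp (-(R * (domSys P M (k + 1)).dj Z))) := by
  -- adapted from file 10 `exists_nbhd_hLayer_of_analyticH_bound238` (the pair datum is read on `sp′ Z ⊇ sp X`)
  intro g hg X
  have hT : ∀ Z : (domSys P M (k + 1)).Dom, IsOpen {φ : CPair P 𝔸 | AnalyticAt ℂ (fun ψ => S.H g ψ Z) φ ∧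
      ‖S.H g φ Z‖ < A' * Real.exp (-(R * (domSys P M (k + 1)).dj Z))} := fun Z =>
    isOpen_iff_mem_nhds.2 fun φ hφ =>
      hφ.1.eventually_analyticAt.and (hφ.1.continuousAt.norm.eventually_lt continuousAt_const hφ.2)
  refine ⟨⋂ Z ∈ {Z : (domSys P M (k + 1)).Dom | Z.1 ⊆ X.1}, {φ : CPair P 𝔸 | AnalyticAt ℂ (fun ψ => S.H g ψ Z) φ ∧
      ‖S.H g φ Z‖ < A' * Real.exp (-(R * (domSys P M (k + 1)).dj Z))},
    (Set.toFinite _).isOpen_biInter fun Z _ => hT Z, fun φ hφ => ?_, fun Z hZ φ hφ => ?_, fun φ hφ Z hZ => ?_⟩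
  · refine mem_iInter₂.2 fun Z hZ => ⟨han g hg Z φ (hrestr X Z hZ hφ), ?_⟩
    exact (h238 g hg Z φ (hrestr X Z hZ hφ)).trans_lt (mul_lt_mul_of_pos_right hAA' (Real.exp_pos _))
  · exact ((mem_iInter₂.1 hφ Z) hZ).1.differentiableAt.differentiableWithinAt
  · exact ((mem_iInter₂.1 hφ Z) hZ).2.le

open Classical in
/-- **FILE 10 §2 ∘ §1 ON A PAIR, STRICT CLAUSE**: the clause `hrestr`, the H-layer pair on `sp′`, the rate clause and the STRICT [KP86] clause ⟹ for every `g ∈ Wk`,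
`X ∈ 𝐃_{k+1}`: `E^{(k+1)}(X; g; ·)` analytic at every point of `sp X` and `‖S.E g φ X‖ ≤ e·G.ν·G.c₁·G.K₀²·A·e^{−r₁ d_{k+1}(X)}` on `sp X`.
[cite: Balaban1988RG2Cluster, p.15 and (2.41) p.21] -/
theorem analyticOnNhd_and_bound_E_of_bound238_table₂ (S : ClusterStep P 𝔸 M k) (Wk : Set (Fin (k + 1) → ℝ))
    (sp sp' : (domSys P M (k + 1)).Dom → Set (CPair P 𝔸)) {A R r₁ : ℝ} (hrestr : ∀ X Z : (domSys P M (k + 1)).Dom, Z.1 ⊆ X.1 → sp X ⊆ sp' Z)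
    (han : S.AnalyticH Wk sp') (h238 : S.Bound238 Wk sp' A R) (hA : 0 ≤ A) (hr₁ : 0 ≤ r₁)
    (hrate : r₁ + 2 * (tgeometry P.d (domCount P M (k + 1))).κ₀ + 2 ≤ R)
    (hsmall : A * Real.exp (5 * r₁ + 1) * (tgeometry P.d (domCount P M (k + 1))).K₀ * (tgeometry P.d (domCount P M (k + 1))).ν *
      (tgeometry P.d (domCount P M (k + 1))).c₁ < 1) :
    ∀ g ∈ Wk, ∀ X : (domSys P M (k + 1)).Dom,
      AnalyticOnNhd ℂ (fun φ => S.E g φ X) (sp X) ∧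
        ∀ φ ∈ sp X, ‖S.E g φ X‖ ≤
          Real.exp 1 * (tgeometry P.d (domCount P M (k + 1))).ν * (tgeometry P.d (domCount P M (k + 1))).c₁ *
            (tgeometry P.d (domCount P M (k + 1))).K₀ ^ 2 * A * Real.exp (-(r₁ * (domSys P M (k + 1)).dj X)) := by
  -- adapted from file 10 `analyticOnNhd_and_bound_E_of_bound238_table` (§1 on the pair feeds file 10's `…_of_hLayer`, amplitude slack read back)
  set G := tgeometry P.d (domCount P M (k + 1)) with hG
  set c := Real.exp (5 * r₁ + 1) * G.K₀ * G.ν * G.c₁ with hc_def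
  have hc : 0 ≤ c := mul_nonneg (mul_nonneg (mul_nonneg (Real.exp_nonneg _) G.K₀_nonneg) G.ν_nonneg) G.c₁_nonneg
  have hAc : A * c < 1 := by simpa only [hc_def, mul_assoc] using hsmall
  obtain ⟨A₁, hAA₁, hA₁⟩ : ∃ A₁, A < A₁ ∧ A₁ * c ≤ 1 := by
    rcases hc.eq_or_lt with h0 | hpos
    · exact ⟨A + 1, lt_add_one A, by rw [← h0, mul_zero]; exact zero_le_one⟩
    · exact ⟨1 / c, by rwa [lt_div_iff₀ hpos], by rw [one_div_mul_cancel hpos.ne']⟩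
  have step : ∀ A', A < A' → A' ≤ A₁ → ∀ g ∈ Wk, ∀ X : (domSys P M (k + 1)).Dom,
      AnalyticOnNhd ℂ (fun φ => S.E g φ X) (sp X) ∧ ∀ φ ∈ sp X, ‖S.E g φ X‖ ≤
        Real.exp 1 * G.ν * G.c₁ * G.K₀ ^ 2 * A' * Real.exp (-(r₁ * (domSys P M (k + 1)).dj X)) := by
    intro A' hAA' hA'₁
    have hclause : A' * Real.exp (5 * r₁ + 1) * G.K₀ * G.ν * G.c₁ ≤ 1 :=
      calc A' * Real.exp (5 * r₁ + 1) * G.K₀ * G.ν * G.c₁ = A' * c := by simp only [hc_def, mul_assoc]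
        _ ≤ A₁ * c := mul_le_mul_of_nonneg_right hA'₁ hc
        _ ≤ 1 := hA₁
    exact analyticOnNhd_and_bound_E_of_hLayer S Wk sp (exists_nbhd_hLayer_of_analyticH_bound238₂ S Wk sp sp' hrestr han h238 hAA')
      (hA.trans hAA'.le) hr₁ hrate hclause
  intro g hg X
  refine ⟨(step A₁ hAA₁ le_rfl g hg X).1, fun φ hφ => ?_⟩
  have hL : 0 ≤ Real.exp 1 * G.ν * G.c₁ * G.K₀ ^ 2 :=
    mul_nonneg (mul_nonneg (mul_nonneg (Real.exp_nonneg _) G.ν_nonneg) G.c₁_nonneg) (sq_nonneg _)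
  exact le_of_forall_gt_amplitude hL (Real.exp_nonneg _) hAA₁ fun A' hAA' hA'₁ => (step A' hAA' hA'₁ g hg X).2 φ hφ

end Pair

/-! ## §2 At `F.P K`: the located numerals, the tower predicates on the smaller table -/

section Four

variable (F : T4Family) (K : ℕ) {𝔸 : Type*} [NormedRing 𝔸] [NormedAlgebra ℂ 𝔸] {M : ℕ}

open Classical in
/-- **§1 AT `F.P K`** (`r₁ + 2·64·log 162 + 2 ≤ R`, STRICT `A·e^{5r₁+1}·K₀(64,8)·9·64 < 1`), pair version. [cite: Balaban1988RG2Cluster, p.15 and (2.41) p.21] -/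
theorem analyticOnNhd_and_bound_E_of_bound238_table_four₂ {k : ℕ} (S : ClusterStep (F.P K) 𝔸 M k) (Wk : Set (Fin (k + 1) → ℝ))
    (sp sp' : (domSys (F.P K) M (k + 1)).Dom → Set (CPair (F.P K) 𝔸)) {A R r₁ : ℝ}
    (hrestr : ∀ X Z : (domSys (F.P K) M (k + 1)).Dom, Z.1 ⊆ X.1 → sp X ⊆ sp' Z)
    (han : S.AnalyticH Wk sp') (h238 : S.Bound238 Wk sp' A R) (hA : 0 ≤ A) (hr₁ : 0 ≤ r₁)
    (hrate : r₁ + 2 * (64 * Real.log 162) + 2 ≤ R) (hsmall : A * Real.exp (5 * r₁ + 1) * K₀ 64 8 * 9 * 64 < 1) :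
    ∀ g ∈ Wk, ∀ X : (domSys (F.P K) M (k + 1)).Dom,
      AnalyticOnNhd ℂ (fun φ => S.E g φ X) (sp X) ∧
        ∀ φ ∈ sp X, ‖S.E g φ X‖ ≤ Real.exp 1 * 9 * 64 * K₀ 64 8 ^ 2 * A * Real.exp (-(r₁ * (domSys (F.P K) M (k + 1)).dj X)) := by
  obtain ⟨hν, hκ₀, hK₀, hc₁⟩ := tgeometry_consts_FP F K (M := M) k
  have h := analyticOnNhd_and_bound_E_of_bound238_table₂ S Wk sp sp' hrestr han h238 hA hr₁ (by rw [hκ₀]; exact hrate)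
    (by rw [hK₀, hν, hc₁]; exact hsmall)
  rw [hν, hc₁, hK₀] at h
  exact h

open Classical in
/-- **`W1.TermAnalytic S W sp` FROM THE H-LAYER PAIR ON THE LARGER TABLES** `sp′ (k+1)`, linked by print's clause at every step. [cite: Balaban1987RG1, §1 p.263 (analytic on U^c_j); Balaban1988RG2Cluster, p.15] -/
theorem termAnalytic_of_bound238_table₂ (S : ClusterTower (F.P K) 𝔸 M) (W : Set (ℕ → ℝ)) (Wk : (k : ℕ) → Set (Fin (k + 1) → ℝ))
    (sp sp' : (j : ℕ) → (domSys (F.P K) M j).Dom → Set (CPair (F.P K) 𝔸)) {A R r₁ : ℝ}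
    (hW : ∀ k, ∀ g ∈ W, restrictPrefix k g ∈ Wk k)
    (hrestr : ∀ k, ∀ X Z : (domSys (F.P K) M (k + 1)).Dom, Z.1 ⊆ X.1 → sp (k + 1) X ⊆ sp' (k + 1) Z)
    (han : ∀ k, (S k).AnalyticH (Wk k) (sp' (k + 1))) (h238 : ∀ k, (S k).Bound238 (Wk k) (sp' (k + 1)) A R) (hA : 0 ≤ A)
    (hr₁ : 0 ≤ r₁) (hrate : r₁ + 2 * (64 * Real.log 162) + 2 ≤ R)
    (hsmall : A * Real.exp (5 * r₁ + 1) * K₀ 64 8 * 9 * 64 < 1) :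
    TermAnalytic S W sp := by
  intro g hg j X
  cases j with
  | zero => exact analyticOnNhd_const
  | succ k =>
    exact (analyticOnNhd_and_bound_E_of_bound238_table_four₂ F K (S k) (Wk k) (sp (k + 1)) (sp' (k + 1)) (hrestr k) (han k) (h238 k) hA
      hr₁ hrate hsmall (restrictPrefix k g) (hW k g hg) X).1

open Classical in
/-- **`W1.TermBound118 S W sp (e·9·64·K₀(64,8)²·A) r₁` — (1.18) ON THE SMALLER TABLES FROM THE H-LAYER PAIR ON THE LARGER ONES**, STRICT clause.
[cite: Balaban1987RG1, (1.18) p.263; Balaban1988RG2Cluster, p.15 and (2.41) p.21] -/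
theorem termBound118_of_bound238_table₂ (S : ClusterTower (F.P K) 𝔸 M) (W : Set (ℕ → ℝ)) (Wk : (k : ℕ) → Set (Fin (k + 1) → ℝ))
    (sp sp' : (j : ℕ) → (domSys (F.P K) M j).Dom → Set (CPair (F.P K) 𝔸)) {A R r₁ : ℝ}
    (hW : ∀ k, ∀ g ∈ W, restrictPrefix k g ∈ Wk k)
    (hrestr : ∀ k, ∀ X Z : (domSys (F.P K) M (k + 1)).Dom, Z.1 ⊆ X.1 → sp (k + 1) X ⊆ sp' (k + 1) Z)
    (han : ∀ k, (S k).AnalyticH (Wk k) (sp' (k + 1))) (h238 : ∀ k, (S k).Bound238 (Wk k) (sp' (k + 1)) A R) (hA : 0 ≤ A)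
    (hr₁ : 0 ≤ r₁) (hrate : r₁ + 2 * (64 * Real.log 162) + 2 ≤ R)
    (hsmall : A * Real.exp (5 * r₁ + 1) * K₀ 64 8 * 9 * 64 < 1) :
    TermBound118 S W sp (Real.exp 1 * 9 * 64 * K₀ 64 8 ^ 2 * A) r₁ := by
  intro g hg j X φ hφ
  cases j with
  | zero =>
    have h0 : ‖termC S 0 X g φ‖ = 0 := by rw [termC_zero, norm_zero]
    rw [h0]
    positivity
  | succ k =>
    exact (analyticOnNhd_and_bound_E_of_bound238_table_four₂ F K (S k) (Wk k) (sp (k + 1)) (sp' (k + 1)) (hrestr k) (han k) (h238 k) hA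
      hr₁ hrate hsmall (restrictPrefix k g) (hW k g hg) X).2 φ hφ

end Four

/-! ## §3 [I] Theorem 1's induction on a table pair -/

section Induction

variable (F : T4Family) (K : ℕ) {𝔸 : Type*} [NormedRing 𝔸] [NormedAlgebra ℂ 𝔸] {M : ℕ}

open Classical in
/-- **THE INDUCTION ON THE LEVEL, ON A PAIR** (file 15 §1 with the step's pair on `sp′`): IF for every step `k` the inductive assumptions ON `sp` at the levels `≤ k`
((1.18)`(E₀, r₁)` + analyticity, every history of `W`) IMPLY the step-`k` H-layer pair ON `sp′ (k+1)` ((STEP₂), DISPLAYED — NODE A ∕ N10 for the terms of record,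
conditional on [I]'s assumptions; print's larger space), THEN — clause `hrestr`, rate clause, STRICT [KP86] clause, renewal `e·9·64·K₀²·A ≤ E₀` — both
inductive assumptions hold ON `sp` at every level. [cite: Balaban1987RG1, Thm 1 p.259 and (1.18) p.263; Balaban1988RG2Cluster, p.15, Lemma 3 (2.38) p.20, (2.41) p.21, p.22] -/
theorem inductiveAssumptions_of_inductiveStep₂ (S : ClusterTower (F.P K) 𝔸 M) (W : Set (ℕ → ℝ)) (Wk : (k : ℕ) → Set (Fin (k + 1) → ℝ))
    (sp sp' : (j : ℕ) → (domSys (F.P K) M j).Dom → Set (CPair (F.P K) 𝔸)) {A R r₁ E₀ : ℝ}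
    (hW : ∀ k, ∀ g ∈ W, restrictPrefix k g ∈ Wk k)
    (hrestr : ∀ k, ∀ X Z : (domSys (F.P K) M (k + 1)).Dom, Z.1 ⊆ X.1 → sp (k + 1) X ⊆ sp' (k + 1) Z)
    (hstep : ∀ k : ℕ,
      (∀ g ∈ W, ∀ j ≤ k, ∀ (X : (domSys (F.P K) M j).Dom), ∀ φ ∈ sp j X,
          ‖termC S j X g φ‖ ≤ E₀ * Real.exp (-(r₁ * (domSys (F.P K) M j).dj X))) →
      (∀ g ∈ W, ∀ j ≤ k, ∀ (X : (domSys (F.P K) M j).Dom), AnalyticOnNhd ℂ (termC S j X g) (sp j X)) →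
      (S k).AnalyticH (Wk k) (sp' (k + 1)) ∧ (S k).Bound238 (Wk k) (sp' (k + 1)) A R)
    (hA : 0 ≤ A) (hr₁ : 0 ≤ r₁) (hrate : r₁ + 2 * (64 * Real.log 162) + 2 ≤ R)
    (hsmall : A * Real.exp (5 * r₁ + 1) * K₀ 64 8 * 9 * 64 < 1) (hrenew : Real.exp 1 * 9 * 64 * K₀ 64 8 ^ 2 * A ≤ E₀) :
    ∀ n : ℕ,
      (∀ g ∈ W, ∀ j ≤ n, ∀ (X : (domSys (F.P K) M j).Dom), ∀ φ ∈ sp j X,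
          ‖termC S j X g φ‖ ≤ E₀ * Real.exp (-(r₁ * (domSys (F.P K) M j).dj X))) ∧
      (∀ g ∈ W, ∀ j ≤ n, ∀ (X : (domSys (F.P K) M j).Dom), AnalyticOnNhd ℂ (termC S j X g) (sp j X)) := by
  -- adapted from file 15 `inductiveAssumptions_of_inductiveStep` (the step's pair read on `sp′` through §2)
  have hM : 0 ≤ Real.exp 1 * 9 * 64 * K₀ 64 8 ^ 2 * A := by positivity
  have hE₀ : 0 ≤ E₀ := le_trans hM hrenew
  intro n
  induction n with
  | zero =>
    refine ⟨fun g _ j hj X φ _ => ?_, fun g _ j hj X => ?_⟩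
    · obtain rfl : j = 0 := Nat.le_zero.mp hj
      rw [termC_zero, norm_zero]
      positivity
    · obtain rfl : j = 0 := Nat.le_zero.mp hj
      exact analyticOnNhd_const
  | succ n ih =>
    obtain ⟨hB, hAn⟩ := ih
    obtain ⟨han, h238⟩ := hstep n hB hAn
    have key := analyticOnNhd_and_bound_E_of_bound238_table_four₂ F K (S n) (Wk n) (sp (n + 1)) (sp' (n + 1)) (hrestr n) han h238 hA
      hr₁ hrate hsmall
    refine ⟨fun g hg j hj X φ hφ => ?_, fun g hg j hj X => ?_⟩
    · rcases Nat.of_le_succ hj with h | rfl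
      · exact hB g hg j h X φ hφ
      · rw [termC_succ]
        exact ((key (restrictPrefix n g) (hW n g hg) X).2 φ hφ).trans (mul_le_mul_of_nonneg_right hrenew (Real.exp_nonneg _))
    · rcases Nat.of_le_succ hj with h | rfl
      · exact hAn g hg j h X
      · exact (key (restrictPrefix n g) (hW n g hg) X).1

open Classical in
/-- **THE H-LAYER PAIR ON `sp′` AT EVERY STEP FROM (STEP₂).** [cite: Balaban1988RG2Cluster, p.15 and Lemma 3 (2.38) p.20; Balaban1987RG1, Thm 1 p.259] -/
theorem hLayer_all_of_inductiveStep₂ (S : ClusterTower (F.P K) 𝔸 M) (W : Set (ℕ → ℝ)) (Wk : (k : ℕ) → Set (Fin (k + 1) → ℝ))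
    (sp sp' : (j : ℕ) → (domSys (F.P K) M j).Dom → Set (CPair (F.P K) 𝔸)) {A R r₁ E₀ : ℝ}
    (hW : ∀ k, ∀ g ∈ W, restrictPrefix k g ∈ Wk k)
    (hrestr : ∀ k, ∀ X Z : (domSys (F.P K) M (k + 1)).Dom, Z.1 ⊆ X.1 → sp (k + 1) X ⊆ sp' (k + 1) Z)
    (hstep : ∀ k : ℕ,
      (∀ g ∈ W, ∀ j ≤ k, ∀ (X : (domSys (F.P K) M j).Dom), ∀ φ ∈ sp j X,
          ‖termC S j X g φ‖ ≤ E₀ * Real.exp (-(r₁ * (domSys (F.P K) M j).dj X))) →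
      (∀ g ∈ W, ∀ j ≤ k, ∀ (X : (domSys (F.P K) M j).Dom), AnalyticOnNhd ℂ (termC S j X g) (sp j X)) →
      (S k).AnalyticH (Wk k) (sp' (k + 1)) ∧ (S k).Bound238 (Wk k) (sp' (k + 1)) A R)
    (hA : 0 ≤ A) (hr₁ : 0 ≤ r₁) (hrate : r₁ + 2 * (64 * Real.log 162) + 2 ≤ R)
    (hsmall : A * Real.exp (5 * r₁ + 1) * K₀ 64 8 * 9 * 64 < 1) (hrenew : Real.exp 1 * 9 * 64 * K₀ 64 8 ^ 2 * A ≤ E₀) :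
    ∀ k, (S k).AnalyticH (Wk k) (sp' (k + 1)) ∧ (S k).Bound238 (Wk k) (sp' (k + 1)) A R := fun k =>
  hstep k (inductiveAssumptions_of_inductiveStep₂ F K S W Wk sp sp' hW hrestr hstep hA hr₁ hrate hsmall hrenew k).1
    (inductiveAssumptions_of_inductiveStep₂ F K S W Wk sp sp' hW hrestr hstep hA hr₁ hrate hsmall hrenew k).2

open Classical in
/-- **(1.18) FOR THE WHOLE TOWER ON `sp` FROM (STEP₂)**: `W1.TermBound118 S W sp E₀ r₁`. [cite: Balaban1987RG1, (1.18) p.263 and Thm 1 p.259; Balaban1988RG2Cluster, (2.41) p.21 and p.22] -/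
theorem termBound118_of_inductiveStep₂ (S : ClusterTower (F.P K) 𝔸 M) (W : Set (ℕ → ℝ)) (Wk : (k : ℕ) → Set (Fin (k + 1) → ℝ))
    (sp sp' : (j : ℕ) → (domSys (F.P K) M j).Dom → Set (CPair (F.P K) 𝔸)) {A R r₁ E₀ : ℝ}
    (hW : ∀ k, ∀ g ∈ W, restrictPrefix k g ∈ Wk k)
    (hrestr : ∀ k, ∀ X Z : (domSys (F.P K) M (k + 1)).Dom, Z.1 ⊆ X.1 → sp (k + 1) X ⊆ sp' (k + 1) Z)
    (hstep : ∀ k : ℕ,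
      (∀ g ∈ W, ∀ j ≤ k, ∀ (X : (domSys (F.P K) M j).Dom), ∀ φ ∈ sp j X,
          ‖termC S j X g φ‖ ≤ E₀ * Real.exp (-(r₁ * (domSys (F.P K) M j).dj X))) →
      (∀ g ∈ W, ∀ j ≤ k, ∀ (X : (domSys (F.P K) M j).Dom), AnalyticOnNhd ℂ (termC S j X g) (sp j X)) →
      (S k).AnalyticH (Wk k) (sp' (k + 1)) ∧ (S k).Bound238 (Wk k) (sp' (k + 1)) A R)
    (hA : 0 ≤ A) (hr₁ : 0 ≤ r₁) (hrate : r₁ + 2 * (64 * Real.log 162) + 2 ≤ R)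
    (hsmall : A * Real.exp (5 * r₁ + 1) * K₀ 64 8 * 9 * 64 < 1) (hrenew : Real.exp 1 * 9 * 64 * K₀ 64 8 ^ 2 * A ≤ E₀) :
    TermBound118 S W sp E₀ r₁ := fun g hg j X φ hφ =>
  (inductiveAssumptions_of_inductiveStep₂ F K S W Wk sp sp' hW hrestr hstep hA hr₁ hrate hsmall hrenew j).1 g hg j le_rfl X φ hφ

open Classical in
/-- **[I] p. 263 ANALYTICITY FOR THE WHOLE TOWER ON `sp` FROM (STEP₂)**: `W1.TermAnalytic S W sp`. [cite: Balaban1987RG1, §1 p.263 and Thm 1 p.259; Balaban1988RG2Cluster, p.15] -/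
theorem termAnalytic_of_inductiveStep₂ (S : ClusterTower (F.P K) 𝔸 M) (W : Set (ℕ → ℝ)) (Wk : (k : ℕ) → Set (Fin (k + 1) → ℝ))
    (sp sp' : (j : ℕ) → (domSys (F.P K) M j).Dom → Set (CPair (F.P K) 𝔸)) {A R r₁ E₀ : ℝ}
    (hW : ∀ k, ∀ g ∈ W, restrictPrefix k g ∈ Wk k)
    (hrestr : ∀ k, ∀ X Z : (domSys (F.P K) M (k + 1)).Dom, Z.1 ⊆ X.1 → sp (k + 1) X ⊆ sp' (k + 1) Z)
    (hstep : ∀ k : ℕ,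
      (∀ g ∈ W, ∀ j ≤ k, ∀ (X : (domSys (F.P K) M j).Dom), ∀ φ ∈ sp j X,
          ‖termC S j X g φ‖ ≤ E₀ * Real.exp (-(r₁ * (domSys (F.P K) M j).dj X))) →
      (∀ g ∈ W, ∀ j ≤ k, ∀ (X : (domSys (F.P K) M j).Dom), AnalyticOnNhd ℂ (termC S j X g) (sp j X)) →
      (S k).AnalyticH (Wk k) (sp' (k + 1)) ∧ (S k).Bound238 (Wk k) (sp' (k + 1)) A R)
    (hA : 0 ≤ A) (hr₁ : 0 ≤ r₁) (hrate : r₁ + 2 * (64 * Real.log 162) + 2 ≤ R)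
    (hsmall : A * Real.exp (5 * r₁ + 1) * K₀ 64 8 * 9 * 64 < 1) (hrenew : Real.exp 1 * 9 * 64 * K₀ 64 8 ^ 2 * A ≤ E₀) :
    TermAnalytic S W sp := fun g hg j X =>
  (inductiveAssumptions_of_inductiveStep₂ F K S W Wk sp sp' hW hrestr hstep hA hr₁ hrate hsmall hrenew j).2 g hg j le_rfl X

end Induction

/-! ## §4 The diagonal: the one-table clause -/

section Diagonal

variable {P : Params} {𝔸 : Type*} {M j : ℕ}

/-- **`W1.SpRestr sp` IS THE TWO-TABLE CLAUSE AT `sp′ = sp`** (so files 10 ∕ 15's theorems are §1–§3's diagonal). [cite: Balaban1988RG2Cluster, p.15] -/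
theorem restr₂_of_spRestr {sp : (domSys P M j).Dom → Set (CPair P 𝔸)} (h : SpRestr sp) :
    ∀ X Z : (domSys P M j).Dom, Z.1 ⊆ X.1 → sp X ⊆ sp Z := fun X Z hZX => h X Z hZX

end Diagonal

/-! ## §5 Print's pair at W1's table, EVERY residual recipe -/

section PrintPair

variable {P : Params} {i : ℕ} {𝔸 : Type*} [NormedRing 𝔸] [NormedAlgebra ℂ 𝔸] [CompleteSpace 𝔸] {𝓜 : Model 𝔸}

/-- **(i)–(iii) ARE ANTITONE IN THE FRAME — no background functions involved** (file 20 §1's `condI_anti_frame`, `condII_anti_region`, `condIII_anti_region`; the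
factorisation `𝐔 = (exp iξA′)U` unchanged). [cite: Balaban1987RG1, (1.11)-(1.14) p.262] -/
theorem satisfiesI_III_anti_frame {F F' : Frame P i 𝔸} {c : StepConsts} {α₀ α₁ γ₀ : ℝ} (hXp : F'.X.plaqs ⊆ F.X.plaqs) (hXb : F'.X.bonds ⊆ F.X.bonds)
    (hXd : F'.X.dpairs ⊆ F.X.dpairs) (hcubes : ∀ C' ∈ F'.cubes, ∃ C ∈ F.cubes, C'.bonds ⊆ C.bonds ∧ C'.dpairs ⊆ C.dpairs) {Φ : FieldPair P i 𝔸ˣ 𝔸}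
    (h : SatisfiesI_III 𝓜 F c α₀ α₁ γ₀ Φ) : SatisfiesI_III 𝓜 F' c α₀ α₁ γ₀ Φ := by
  obtain ⟨hG, hg, U, A', hf, h1, h2, h3⟩ := h
  exact ⟨fun b hb => hG b (hXb hb), fun b hb => hg b (hXb hb), U, A', hf, condI_anti_frame hXb hXp hcubes h1, condII_anti_region hXb hXd h2,
    condIII_anti_region hXp hXb h3⟩

/-- **★ PRINT's RESTRICTION, ANY FRAME PAIR**: `U^c(F, α₀, α₁, γ₀) ⊆ {Φ^u : u Gᶜ-valued, Φ satisfies (i)–(iii) on F′ with radii α₀′, α₁′, γ₀′}` for a refined frame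
`F′ ≼ F` (regions and cubes; `F′.X₂`, `F′.bg` play no rôle) and `α ≤ α′`, `0 ≤ O(1)LMB` — (iv) is dropped on `F′`, (i)–(iii) restricted and their radii enlarged.
[cite: Balaban1988RG2Cluster, p.15; Balaban1987RG1, (1.17) p.263 and (3.16) p.273] -/
theorem space_subset_orbitI_III {F F' : Frame P i 𝔸} {c : StepConsts} (hc : 0 ≤ c.cB) {α₀ α₀' α₁ α₁' γ₀ γ₀' : ℝ} (hα₀ : α₀ ≤ α₀') (hα₁ : α₁ ≤ α₁')
    (hγ : γ₀ ≤ γ₀') (hXp : F'.X.plaqs ⊆ F.X.plaqs) (hXb : F'.X.bonds ⊆ F.X.bonds) (hXd : F'.X.dpairs ⊆ F.X.dpairs)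
    (hcubes : ∀ C' ∈ F'.cubes, ∃ C ∈ F.cubes, C'.bonds ⊆ C.bonds ∧ C'.dpairs ⊆ C.dpairs) :
    space 𝓜 F c α₀ α₁ γ₀ ⊆ {Φ | ∃ (u : Site P i → 𝔸ˣ) (Φ₀ : FieldPair P i 𝔸ˣ 𝔸),
      (∀ x, u x ∈ 𝓜.Gc) ∧ SatisfiesI_III 𝓜 F' c α₀' α₁' γ₀' Φ₀ ∧ Φ = act u Φ₀} := by
  rintro Φ ⟨u, Φ₀, hu, h₀, rfl⟩
  exact ⟨u, Φ₀, hu, satisfiesI_III_mono hc hα₀ hα₁ hγ (satisfiesI_III_anti_frame hXp hXb hXd hcubes h₀.toI_III), rfl⟩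

variable {M : ℕ}

/-- **★★ PRINT's RESTRICTION AT W1's TABLE, EVERY RESIDUAL RECIPE**: for `Z ⊂ X` in `𝐃_j`, radii tables with `α₀ j ≤ α₀′ j`, `α₁ j ≤ α₁′ j` and `0 ≤ O(1)LMB`,
`U^c_j(X, α₀ j, α₁ j)` (`W1.spaceOfRecord Sg Rz α₀ α₁ j X`, conditions (i)–(iv)) lies in the (i)–(iii)-ORBIT TABLE on `Z` with radii `α₀′ j, α₁′ j` (the image in `Φ` of
the `Gᶜ`-orbits of the pairs satisfying (i)–(iii) on the frame of record of `Z`) — [II] p. 15's «space of configurations (U, J) satisfying the conditions I.(i)–(iii) on the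
domain Z, with constants α₀′, α₁′», NO law on `Rz` (condition (iv), the only domain-dependent one, is not asked on `Z`). [cite: Balaban1988RG2Cluster, p.15; Balaban1987RG1, (1.11)-(1.16) p.262 and (3.16) p.273] -/
theorem spaceOfRecord_subset_orbitI_III {G : Type*} [Group G] (Sg : Setting 𝔸 G) (hS : 0 ≤ Sg.cB) (Rz : Residual P 𝔸) (α₀ α₁ α₀' α₁' : ℕ → ℝ) (j : ℕ)
    (hα₀ : α₀ j ≤ α₀' j) (hα₁ : α₁ j ≤ α₁' j) {X Z : (domSys P M j).Dom} (hZX : (Subtype.val Z : Finset (TPt P.d (domCount P M j))) ⊆ Subtype.val X) :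
    spaceOfRecord (M := M) Sg Rz α₀ α₁ j X ⊆ embedPair '' {Φ | ∃ (u : Site P 0 → 𝔸ˣ) (Φ₀ : FieldPair P 0 𝔸ˣ 𝔸), (∀ x, u x ∈ Sg.𝓜.Gc) ∧
      SatisfiesI_III Sg.𝓜 (frameI Rz M j (domSites P M j Z)) (StepConsts.ofParams P Sg.cB j) (α₀' j) (α₁' j) (α₀' j) Φ₀ ∧ Φ = act u Φ₀} :=
  Set.image_mono (space_subset_orbitI_III (F := frameI Rz M j (domSites P M j X)) (F' := frameI Rz M j (domSites P M j Z))
    (c := StepConsts.ofParams P Sg.cB j) hS hα₀ hα₁ hα₀ (regionOfSet_plaqs_mono (domSites_mono hZX)) (regionOfSet_bonds_mono (domSites_mono hZX))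
    (regionOfSet_dpairs_mono (domSites_mono hZX)) (cubesI_refine M j (domSites_mono hZX)))

/-- **★★★ THE CLAUSE OF §1–§3 FOR THE PAIR OF RECORD, in the consumers' shape** `∀ k X Z, Z ⊂ X → sp (k+1) X ⊆ sp′ (k+1) Z`: `sp := W1.spaceOfRecord Sg Rz α₀ α₁`,
`sp′ j Z :=` the (i)–(iii)-orbit table on `Z` with radii `α₀′ j ≥ α₀ j`, `α₁′ j ≥ α₁ j` — EVERY residual recipe, EVERY torus, every cube size; so §3's induction runs at W1's
table of record with the step's pair asked on print's larger space, independently of the (C3) placeholder. [cite: Balaban1988RG2Cluster, p.15; Balaban1987RG1, (3.16) p.273] -/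
theorem restr₂_spaceOfRecord_orbitI_III {G : Type*} [Group G] (Sg : Setting 𝔸 G) (hS : 0 ≤ Sg.cB) (Rz : Residual P 𝔸) (α₀ α₁ α₀' α₁' : ℕ → ℝ)
    (hα₀ : ∀ j, α₀ j ≤ α₀' j) (hα₁ : ∀ j, α₁ j ≤ α₁' j) :
    ∀ k, ∀ X Z : (domSys P M (k + 1)).Dom, Z.1 ⊆ X.1 →
      spaceOfRecord (M := M) Sg Rz α₀ α₁ (k + 1) X ⊆ embedPair '' {Φ | ∃ (u : Site P 0 → 𝔸ˣ) (Φ₀ : FieldPair P 0 𝔸ˣ 𝔸), (∀ x, u x ∈ Sg.𝓜.Gc) ∧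
        SatisfiesI_III Sg.𝓜 (frameI Rz M (k + 1) (domSites P M (k + 1) Z)) (StepConsts.ofParams P Sg.cB (k + 1)) (α₀' (k + 1)) (α₁' (k + 1))
          (α₀' (k + 1)) Φ₀ ∧ Φ = act u Φ₀} :=
  fun k _ _ hZX => spaceOfRecord_subset_orbitI_III Sg hS Rz α₀ α₁ α₀' α₁' (k + 1) (hα₀ _) (hα₁ _) hZX

end PrintPair

/-! ## §5b (1.18) on the table of record from the H-layer pair on print's larger space -/

section RecordPair

variable (F : T4Family) (N : ℕ) {M : ℕ}

open Classical in
/-- **(1.18) ON THE TABLE OF RECORD FROM THE H-LAYER PAIR ON PRINT's (i)–(iii)-SPACE WITH LARGER RADII** — §2's `termBound118_of_bound238_table₂` at the pair of record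
(`sp := W1.spaceOfRecord Sg Rz α₀ α₁`, `sp′ :=` the (i)–(iii)-orbit tables with radii `α′ ≥ α`), the clause DISCHARGED by §5 for EVERY residual recipe `Rz` and every setting
with `0 ≤ O(1)LMB`; displayed remain the per-step `AnalyticH` ∕ `Bound238` ON THE LARGER SPACE (NODE A ∕ N10 for the terms of record — print's own statement, [II] p. 15),
the window law and the located numerals. [cite: Balaban1987RG1, (1.18) p.263; Balaban1988RG2Cluster, p.15, Lemma 3 (2.38) p.20, (2.41) p.21] -/
theorem termBound118_spaceOfRecord_of_pair {K : ℕ} (Sg : Setting (MatA N) (SU N)) (hS : 0 ≤ Sg.cB) (Rz : Residual (F.P K) (MatA N))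
    (α₀ α₁ α₀' α₁' : ℕ → ℝ) (hα₀ : ∀ j, α₀ j ≤ α₀' j) (hα₁ : ∀ j, α₁ j ≤ α₁' j)
    (S : ClusterTower (F.P K) (MatA N) M) (W : Set (ℕ → ℝ)) (Wk : (k : ℕ) → Set (Fin (k + 1) → ℝ)) {A R r₁ : ℝ}
    (hW : ∀ k, ∀ g ∈ W, restrictPrefix k g ∈ Wk k)
    (han : ∀ k, (S k).AnalyticH (Wk k) fun Z => embedPair '' {Φ | ∃ (u : Site (F.P K) 0 → (MatA N)ˣ) (Φ₀ : FieldPair (F.P K) 0 (MatA N)ˣ (MatA N)),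
      (∀ x, u x ∈ Sg.𝓜.Gc) ∧ SatisfiesI_III Sg.𝓜 (frameI Rz M (k + 1) (domSites (F.P K) M (k + 1) Z)) (StepConsts.ofParams (F.P K) Sg.cB (k + 1))
        (α₀' (k + 1)) (α₁' (k + 1)) (α₀' (k + 1)) Φ₀ ∧ Φ = act u Φ₀})
    (h238 : ∀ k, (S k).Bound238 (Wk k) (fun Z => embedPair '' {Φ | ∃ (u : Site (F.P K) 0 → (MatA N)ˣ) (Φ₀ : FieldPair (F.P K) 0 (MatA N)ˣ (MatA N)),
      (∀ x, u x ∈ Sg.𝓜.Gc) ∧ SatisfiesI_III Sg.𝓜 (frameI Rz M (k + 1) (domSites (F.P K) M (k + 1) Z)) (StepConsts.ofParams (F.P K) Sg.cB (k + 1))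
        (α₀' (k + 1)) (α₁' (k + 1)) (α₀' (k + 1)) Φ₀ ∧ Φ = act u Φ₀}) A R)
    (hA : 0 ≤ A) (hr₁ : 0 ≤ r₁) (hrate : r₁ + 2 * (64 * Real.log 162) + 2 ≤ R) (hsmall : A * Real.exp (5 * r₁ + 1) * K₀ 64 8 * 9 * 64 < 1) :
    TermBound118 S W (spaceOfRecord (M := M) Sg Rz α₀ α₁) (Real.exp 1 * 9 * 64 * K₀ 64 8 ^ 2 * A) r₁ :=
  termBound118_of_bound238_table₂ F K S W Wk (spaceOfRecord (M := M) Sg Rz α₀ α₁)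
    (fun j Z => embedPair '' {Φ | ∃ (u : Site (F.P K) 0 → (MatA N)ˣ) (Φ₀ : FieldPair (F.P K) 0 (MatA N)ˣ (MatA N)),
      (∀ x, u x ∈ Sg.𝓜.Gc) ∧ SatisfiesI_III Sg.𝓜 (frameI Rz M j (domSites (F.P K) M j Z)) (StepConsts.ofParams (F.P K) Sg.cB j) (α₀' j) (α₁' j) (α₀' j) Φ₀ ∧
        Φ = act u Φ₀})
    hW (restr₂_spaceOfRecord_orbitI_III Sg hS Rz α₀ α₁ α₀' α₁' hα₀ hα₁) han h238 hA hr₁ hrate hsmall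

end RecordPair

end Summit.QuantumFields.YangMills.BalabanUVNodes.N18HLayerW1TwoRadii

end
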